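import Summits.HodgeConjecture.HodgeConjecture.Theorems.H413OmegaAtLineGramCoinv
import Literature.NumberTheory.GelbartRogawski1991.UnitaryDualPairWeilCoinvariantsReference
import Literature.NumberTheory.GelbartRogawski1991.UnitaryDualPairWeilCoinvariantsSmooth
import HarnessLib

/-!
# FLOOR-0 P4, seat S4′(i) ∕ S4b, step (1b) — the μ-splitting's coinvariants against the model's CHOSEN splitting, up to the finite twist character

Cell hodgecm-mathlib (D-0151), FLOOR 0, crux item H413 = stmt-HodgeConjecture-24833; programme P4, line `Cruxes/H413/Lines/F0_P4AdmissibleOccursInH1.lean`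
(ed. 2), stub S4b.  Author F0P4-p01 (g0) (seat (i)); SEAT-i MEMO v2 §5 (J-a), NOTES step (1b).  `--supports stmt-HodgeConjecture-24833 --as helper`.  DEF-FREE.

At the model's W-spelling `(diagonal dV, diagonal dW)` there are TWO compatible splittings of one datum: the μ-splitting `chiSplitting θ dW` (★ `isCompatible_chiSplitting`;
the pin's, after ★ p795555 `exists_coinv_equiv_TW_lineVec`) and the model's chosen `splittingOf h` (★ `splittingOf_isCompatible`; the one inside `finRepZero`, ★ p793257).
★ `UnitaryDualPairWeilCoinvariantsReference` says their finite Weil representations differ by a continuous character `χtw` of the finite-adelic pair and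
identifies the coinvariants accordingly.  **`exists_coinv_equiv_chiSplitting_splittingOf`**: for every character `χ'` of `U(diag dW)(𝔸_f)` there are a continuous
`χtw` and `T : Coinv (finPairRepW[chiSplitting θ dW]) χ' ≃ₗ[ℂ] Coinv ((finPairRep[splittingOf h]) ∘ inr) ((χtw ∘ inr)⁻¹ · χ')` with `T (mk f) = mk f` and the law
`T (weilCoinv[chiSplitting] χ' k x) = χtw (k,1) • rep ((finPairRep[splittingOf h]) ∘ inl) k (T x)` — i.e. the `Ψ`, `λ := χtw(·,1)` of ★ `exists_holReal_of_transport`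
(composed with p795555's on-the-nose `Ψ` at the pin spelling).  HC_CM is proved only modulo the printed citations until rung 0 closes.

## References
* [GelbartRogawski1991] S. Gelbart, J. Rogawski, Invent. Math. 105 (1991), §3.1 Prop. 3.1.1 p. 455, Remark p. 457 L4–13.
* [Liu2021] Y. Liu, Camb. J. Math. 9 (2021), Def. 4.11 (l. 2092–2096), App. D §D.1 Steps 1–3 (l. 5214–5219).
* Tree: ★ `GelbartRogawski1991/UnitaryDualPairWeilCoinvariantsReference` (`exists_eq_twist_finPairSection_continuous`, `exists_weilCoinv_equiv_reference`),
  ★ `…UnitaryDualPairSeesawDeepLevelFixed` (`proj_pairSmall₁`), ★ `…WeilCoinvariantsSmooth` (`continuous_pairSmall₁_comp_finPairToAdelic`),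
  ★ `Liu2021/Def411WeilCarriersDoubling` (`chiSplitting`, `isCompatible_chiSplitting`, `continuous_pairSplitting_chiSplitting`), ★ `…UnitaryDualPairThetaKernel` (`splittingOf`).
-/

set_option autoImplicit false
set_option linter.dupNamespace false

noncomputable section

open scoped Matrix Kronecker
open NumberField IsDedekindDomain
open Literature.NumberTheory.Automorphic Literature.NumberTheory.Automorphic.UnitaryGroup
open Literature.NumberTheory.Weil1964
open Literature.NumberTheory.GelbartRogawski1991 Literature.NumberTheory.GelbartRogawski1991.UnitaryDualPair
open Literature.NumberTheory.GelbartRogawski1991.UnitaryDualPair.WeilCoinv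
open Literature.NumberTheory.Automorphic.Liu2021.Def411WeilCarriersDoubling
open Literature.NumberTheory.GelbartRogawski1991.GRConstruction (Fp)
open Literature.NumberTheory.GaloisRepresentations (HeckeCharacter)
open Literature.RepresentationTheory.HarrisKudlaSweet1996 (IsSplittingChar)

namespace Summit.HodgeConjecture.HodgeConjecture.Cruxes.H413.ThetaJunction

variable (L : Type) [Field L] [NumberField L] [IsCMField L] {N' n' : ℕ} (e₁ : Fin N' × Fin 1 ≃ Fin n')
  (dV₁ : Fin N' → L) (hdV₁ : ∀ i, IsCMField.complexConj L (dV₁ i) = dV₁ i) (hdV₁0 : ∀ i, dV₁ i ≠ 0)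
  (dW : Fin 1 → L) (hdW : ∀ i, IsCMField.complexConj L (dW i) = dW i) (hdW0 : ∀ i, dW i ≠ 0)
  (θ : HeckeCharacter L) (hθu : θ.IsUnitary) (hθs : IsSplittingChar L 1 θ)
  (h : (splittingDatum (Fp L) L (IsCMField.complexConj L) N' 1 e₁ (Matrix.diagonal dV₁) (Matrix.diagonal dW) (complexConj_imagUnit L)
      (imagUnit_ne_zero L) (imagUnit_mul_self L) (realDiagonal_isSymm L dV₁ hdV₁) (realDiagonal_isSymm L dW hdW)
      (isUnit_det_realDiagonal L dV₁ hdV₁ hdV₁0) (isUnit_det_realDiagonal L dW hdW hdW0) (realDiagonal_map L dV₁ hdV₁).symm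
      (realDiagonal_map L dW hdW).symm).CompatibleSplitting)
  (χ' : UnitaryGroup.finAdelic (Fp L) L (IsCMField.complexConj L) 1 (Matrix.diagonal dW) →* ℂˣ)

set_option maxHeartbeats 4000000 in
/-- **step (1b): `Coinv[chiSplitting θ dW] ≃ Coinv[splittingOf h]` up to the finite twist character `χtw`.** See the module docstring.
[cite: GelbartRogawski1991, §3.1 Prop. 3.1.1 p. 455; Remark p. 457 L4–13] [cite: Liu2021, App. D §D.1 Steps 1–3 (l. 5214–5219)] -/
theorem exists_coinv_equiv_chiSplitting_splittingOf :
    ∃ (χtw : UnitaryGroup.finAdelic (Fp L) L (IsCMField.complexConj L) N' (Matrix.diagonal dV₁) ×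
          UnitaryGroup.finAdelic (Fp L) L (IsCMField.complexConj L) 1 (Matrix.diagonal dW) →* ℂˣ),
      Continuous χtw ∧
      ∃ T : Literature.RepresentationTheory.TwistedCoinv.Coinv
            (finPairRepW (Fp L) L (IsCMField.complexConj L) N' 1 e₁ (Matrix.diagonal dV₁) (Matrix.diagonal dW) (complexConj_imagUnit L)
              (imagUnit_ne_zero L) (imagUnit_mul_self L) (realDiagonal_isSymm L dV₁ hdV₁) (realDiagonal_isSymm L dW hdW)
              (isUnit_det_realDiagonal L dV₁ hdV₁ hdV₁0) (isUnit_det_realDiagonal L dW hdW hdW0) (realDiagonal_map L dV₁ hdV₁).symm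
              (realDiagonal_map L dW hdW).symm (isCompatible_chiSplitting L e₁ dV₁ hdV₁ hdV₁0 dW hdW hdW0 θ hθu hθs)) χ' ≃ₗ[ℂ]
          Literature.RepresentationTheory.TwistedCoinv.Coinv
            ((finPairRep (Fp L) L (IsCMField.complexConj L) N' 1 e₁ (Matrix.diagonal dV₁) (Matrix.diagonal dW) (complexConj_imagUnit L)
              (imagUnit_ne_zero L) (imagUnit_mul_self L) (realDiagonal_isSymm L dV₁ hdV₁) (realDiagonal_isSymm L dW hdW)
              (isUnit_det_realDiagonal L dV₁ hdV₁ hdV₁0) (isUnit_det_realDiagonal L dW hdW hdW0) (realDiagonal_map L dV₁ hdV₁).symm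
              (realDiagonal_map L dW hdW).symm
              (splittingOf_isCompatible _ _ _ _ _ _ _ _ _ _ _ _ _ _ _ _ _ h)).comp (MonoidHom.inr _ _))
            ((χtw.comp (MonoidHom.inr _ _))⁻¹ * χ'),
        (∀ f, T (Literature.RepresentationTheory.TwistedCoinv.mk _ χ' f) = Literature.RepresentationTheory.TwistedCoinv.mk _ _ f) ∧
        ∀ (k : UnitaryGroup.finAdelic (Fp L) L (IsCMField.complexConj L) N' (Matrix.diagonal dV₁)) x,
          T (weilCoinv (Fp L) L (IsCMField.complexConj L) N' 1 e₁ (Matrix.diagonal dV₁) (Matrix.diagonal dW) (complexConj_imagUnit L)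
              (imagUnit_ne_zero L) (imagUnit_mul_self L) (realDiagonal_isSymm L dV₁ hdV₁) (realDiagonal_isSymm L dW hdW)
              (isUnit_det_realDiagonal L dV₁ hdV₁ hdV₁0) (isUnit_det_realDiagonal L dW hdW hdW0) (realDiagonal_map L dV₁ hdV₁).symm
              (realDiagonal_map L dW hdW).symm χ' (isCompatible_chiSplitting L e₁ dV₁ hdV₁ hdV₁0 dW hdW hdW0 θ hθu hθs) k x) =
            ((χtw (k, 1) : ℂˣ) : ℂ) •
              Literature.RepresentationTheory.TwistedCoinv.rep ((χtw.comp (MonoidHom.inr _ _))⁻¹ * χ')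
                ((finPairRep (Fp L) L (IsCMField.complexConj L) N' 1 e₁ (Matrix.diagonal dV₁) (Matrix.diagonal dW) (complexConj_imagUnit L)
                  (imagUnit_ne_zero L) (imagUnit_mul_self L) (realDiagonal_isSymm L dV₁ hdV₁) (realDiagonal_isSymm L dW hdW)
                  (isUnit_det_realDiagonal L dV₁ hdV₁ hdV₁0) (isUnit_det_realDiagonal L dW hdW hdW0) (realDiagonal_map L dV₁ hdV₁).symm
                  (realDiagonal_map L dW hdW).symm
                  (splittingOf_isCompatible _ _ _ _ _ _ _ _ _ _ _ _ _ _ _ _ _ h)).comp (MonoidHom.inl _ _))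
                (commute_comp_inl_comp_inr _) k (T x) := by
  have hs := isCompatible_chiSplitting L e₁ dV₁ hdV₁ hdV₁0 dW hdW hdW0 θ hθu hθs
  have hs' := splittingOf_isCompatible (Fp L) L (IsCMField.complexConj L) N' 1 e₁ (Matrix.diagonal dV₁) (Matrix.diagonal dW)
    (complexConj_imagUnit L) (imagUnit_ne_zero L) (imagUnit_mul_self L) (realDiagonal_isSymm L dV₁ hdV₁) (realDiagonal_isSymm L dW hdW)
    (isUnit_det_realDiagonal L dV₁ hdV₁ hdV₁0) (isUnit_det_realDiagonal L dW hdW hdW0) (realDiagonal_map L dV₁ hdV₁).symm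
    (realDiagonal_map L dW hdW).symm h
  -- the reference section: the finite restriction of the model's chosen splitting; same symplectic map as the μ-splitting's
  have hproj : ∀ p, adelicMpCont.proj (Fp L) (Fin N' × Fin 1) _
      (((pairSmall₁ (Fp L) L (IsCMField.complexConj L) N' 1 e₁ (Matrix.diagonal dV₁) (Matrix.diagonal dW) (splittingOf _ _ _ _ _ _ _ _ _ _ _ _ _ _ _ _ _ h)).comp
        (finPairToAdelic (Fp L) L (IsCMField.complexConj L) N' 1 (Matrix.diagonal dV₁) (Matrix.diagonal dW))) p) =
      adelicMpCont.proj (Fp L) (Fin N' × Fin 1) _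
        (((pairSmall₁ (Fp L) L (IsCMField.complexConj L) N' 1 e₁ (Matrix.diagonal dV₁) (Matrix.diagonal dW)
            (chiSplitting L e₁ dV₁ hdV₁ hdV₁0 dW hdW hdW0 θ hθu hθs)).comp
          (finPairToAdelic (Fp L) L (IsCMField.complexConj L) N' 1 (Matrix.diagonal dV₁) (Matrix.diagonal dW))) p) := fun p =>
    (proj_pairSmall₁ (Fp L) L (IsCMField.complexConj L) N' 1 e₁ (Matrix.diagonal dV₁) (Matrix.diagonal dW) _ _ _ _ _ _ _ _ _ hs' _).trans
      (proj_pairSmall₁ (Fp L) L (IsCMField.complexConj L) N' 1 e₁ (Matrix.diagonal dV₁) (Matrix.diagonal dW) _ _ _ _ _ _ _ _ _ hs _).symm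
  obtain ⟨χtw, hχc, hχtw⟩ := exists_eq_twist_finPairSection_continuous (Fp L) L (IsCMField.complexConj L) N' 1 e₁ (Matrix.diagonal dV₁)
    (Matrix.diagonal dW) (isUnit_det_realDiagonal L dV₁ hdV₁ hdV₁0) (isUnit_det_realDiagonal L dW hdW hdW0) _ hproj
    (continuous_pairSplitting_chiSplitting L e₁ dV₁ hdV₁ hdV₁0 dW hdW hdW0 θ hθu hθs)
    (continuous_pairSmall₁_comp_finPairToAdelic (Fp L) L (IsCMField.complexConj L) N' 1 e₁ (Matrix.diagonal dV₁) (Matrix.diagonal dW)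
      (continuous_pairSplitting_splittingOf _ _ _ _ _ _ _ _ _ _ _ _ _ _ _ _ _ h))
  obtain ⟨T, hTmk, hTlaw⟩ := exists_weilCoinv_equiv_reference (Fp L) L (IsCMField.complexConj L) N' 1 e₁ (Matrix.diagonal dV₁) (Matrix.diagonal dW)
    (complexConj_imagUnit L) (imagUnit_ne_zero L) (imagUnit_mul_self L) (realDiagonal_isSymm L dV₁ hdV₁) (realDiagonal_isSymm L dW hdW)
    (isUnit_det_realDiagonal L dV₁ hdV₁ hdV₁0) (isUnit_det_realDiagonal L dW hdW hdW0) (realDiagonal_map L dV₁ hdV₁).symm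
    (realDiagonal_map L dW hdW).symm hproj hχtw hs (χ' := χ') (χ'' := (χtw.comp (MonoidHom.inr _ _))⁻¹ * χ')
    (fun u => by rw [MonoidHom.mul_apply, MonoidHom.inv_apply, MonoidHom.comp_apply, MonoidHom.inr_apply, mul_inv_cancel_left])
  exact ⟨χtw, hχc, T, hTmk, hTlaw⟩

end Summit.HodgeConjecture.HodgeConjecture.Cruxes.H413.ThetaJunction

end
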